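import Literature.AnabelianGeometry.EtaleTheta.Discharge.Sec2DeltaThetaTorsionFree
import Literature.AnabelianGeometry.EtaleTheta.Discharge.Sec2FreeGenerators
import Literature.AnabelianGeometry.EtaleTheta.Discharge.Sec1ZHatHeisenbergLevels
import HarnessLib

/-!
# [EtTh] §1 p. 12: "`∧² Δ^ell_X (≅ Ẑ(1))`" — the commutator quotient `[Δ_X,Δ_X]⁻/[[Δ_X,Δ_X],Δ_X]⁻`
# of the free profinite group `Δ_X` IS `Ẑ` (proof-only; the pure profinite core of GAP-LEDGER
# G-w4d021-1 «(l·Δ_Θ)(M) ≅ Ẑ(1)»)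

Mochizuki, *The étale theta function and its Frobenioid-theoretic manifestations*, Publ. RIMS **45**
(2009) [EtTh], §1, PRIMS PDF p. 12 (printed 238): "Since `Δ_X` is a profinite free group on 2
generators, we also have a natural exact sequence `1 → ∧² Δ^ell_X (≅ Ẑ(1)) → Δ^Θ_X → Δ^ell_X → 1` —
where we write `Δ^Θ_X := Δ_X/[Δ_X,[Δ_X,Δ_X]]`" [cite: MochizukiEtTh2009, §1 p.12]. Layer L2 of the
abc-iut cell; seat abc-iut-w5-d171 (wave 5), part (C) of the three-part discharge of the hypothesis
binder `hZ : Nonempty (ModelCyclotomes.lDeltaQuot R ≃* ZHat)` of the [IUTchII] Prop. 1.2 Tate-curve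
theorems (plan/GAP-LEDGER.md row G-w4d021-1; parts (A′) tempered transport `Δ_Θ ≅ Ẑ` and (B) the
`rigidData` transport are abc-iut-L2-d1's / abc-iut-w5-d218's). PROOF-ONLY companion of
`Setting.lean` (abc-iut-L2-t1) and `Discharge/Sec2DeltaThetaTorsionFree.lean` (abc-iut-L2-t8, which
proved TORSION-FREENESS of the same quotient and recorded "procyclicity … NOT claimed"); no definition,
no instance, nothing of another seat is edited or restated.

WHAT IS PROVED.  For `D : ThetaSetting p` under the vacuity guard `D.IsEtThOrigin` ("`Δ_X` is a
profinite free group on 2 generators", p. 12), with `Δ_X = D.DeltaHat ≤ Π_X = D.PiHat`,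
`K₂ = [Δ_X,Δ_X]⁻`, `K₃ = [[Δ_X,Δ_X],Δ_X]⁻` (closures in `Π_X`, the kernels printed in `Setting.lean`):
* `IsEtThOrigin.exists_hom_commutatorClosure_zHat` (instance-free workhorse) — topological generators
  `a, b` of `Δ_X` and a SURJECTIVE homomorphism `φ : K₂ → Ẑ` with kernel EXACTLY `K₃`, `φ [a, b] = η 1`
  (`Ẑ` = Mathlib's profinite completion of `ℤ` = the tree's `SemiGraphs.ZHat = IUT.HodgeTheaters.ZHat`);
* `IsEtThOrigin.exists_zHat_param_commutatorClosure` — the same as `K₂/K₃ ≃* Ẑ`, `[a,b] ↦ η 1` (the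
  quotient's `Group` structure needs `K₃.Normal` as an instance-implicit binder: no instances here);
* `IsEtThOrigin.nonempty_commutatorQuotient_mulEquiv_zHat` — `Nonempty (K₂/K₃ ≃* Ẑ)`.
(`Ẑ`-level plumbing and the Heisenberg test groups: `Discharge/Sec1ZHatHeisenbergLevels.lean`.)

PROOF (classical profinite group theory; "the well-known structure of the theta-group", [EtTh] p. 45).
Let `c = [a, b]` for the free topological generators `a, b` (`Sec2FreeGenerators`).  (0) The
`Ẑ`-POWERS of `c`: the continuous homomorphism `pw : Ẑ → Δ_X` extending `m ↦ c^m` (Mathlib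
`ProfiniteGrp.ProfiniteCompletion.lift`); `pw(Ẑ) ⊆ K₂` (closedness, density of `η(ℤ)`).
(1) DECOMPOSITION `K₂ = c^Ẑ · K₃`: `S := pw(Ẑ)·K₃` is a CLOSED subgroup (image of the compact
`Ẑ × K₃`); in the class-two quotient `Π_X/K₃` every commutator of elements of `⟨a, b⟩` is a power of
`[a, b]` (Witt–Hall normal forms, `DtpYAbelian.commutator_le_zpowers_of_classTwo` of the torsion-free
file), so `[u, v] ∈ S` for `u, v ∈ ⟨a, b⟩`, hence — `⟨a, b⟩` dense, `S` closed, the commutator map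
continuous — for all `u, v ∈ Δ_X`; thus `[Δ_X,Δ_X] ≤ S` and `K₂ ≤ S`.  (2) INJECTIVITY via FINITE
HEISENBERG QUOTIENTS: for each `n ≥ 1` the Heisenberg group `H(ℤ/n)` receives a continuous
`F : Δ_X → H(ℤ/n)` with `F a = x`, `F b = y` (freeness), killing `K₃` (class two) and with
`F(pw t) = [x,y]^{t mod n}` (density of `η(ℤ)`, continuity); `[x, y]` has order `n`, so `pw t ∈ K₃`
forces `t ≡ 0 mod n` for every `n`, i.e. `t = 1` in `Ẑ` (finite-index subgroups of `ℤ` are the `nℤ`).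
(3) Hence `t ↦ [pw t]` is a bijective homomorphism `Ẑ → K₂/K₃`; `φ` is its inverse composed with the
projection.  No separation lemma and no choice of compatible Heisenberg levels is needed.

HONEST FRAMING: [EtTh] is refereed; the theta setting is data quoting print and is not asserted to
exist; this is OUR kernel check of the printed "`≅ Ẑ(1)`" as an abstract group (the Tate twist /
`G_K`-action is NOT claimed here); nothing here takes a side on [IUTchIII] Cor. 3.12; typed ≠ proved
elsewhere is untouched.
-/

noncomputable section

namespace Literature.AnabelianGeometry.EtaleTheta

open Literature.AnabelianGeometry.SemiGraphs Literature.Algebra.Homology Literature.Topology.FourManifolds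
open _root_.Topology
open scoped commutatorElement
open CategoryTheory ClassTwo DtpYAbelian groupCohomology ProfiniteGrp ProfiniteGrp.ProfiniteCompletion



/-! ### The theta setting: `[Δ_X,Δ_X]⁻/[[Δ_X,Δ_X],Δ_X]⁻ ≅ Ẑ` -/

namespace ThetaSetting

open ZHatLevels

variable {p : ℕ} [Fact p.Prime] (D : ThetaSetting p)

/-- **`[Δ_X,Δ_X]⁻/[[Δ_X,Δ_X],Δ_X]⁻ ≅ Ẑ`, instance-free form** ("`1 → ∧² Δ^ell_X (≅ Ẑ(1)) → Δ^Θ_X →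
Δ^ell_X → 1`", p. 12): under the freeness guard `IsEtThOrigin` there are topological generators
`a, b` of `Δ_X` and a SURJECTIVE homomorphism `φ : [Δ_X,Δ_X]⁻ → Ẑ` whose kernel is EXACTLY
`[[Δ_X,Δ_X],Δ_X]⁻` and which sends the commutator `[a, b]` to `η(1)`, the image of `1 ∈ ℤ` in `Ẑ`.
See the module docstring for the proof (decomposition `K₂ = [a,b]^Ẑ·K₃` + finite Heisenberg quotients).
[cite: MochizukiEtTh2009, §1 p.12] -/
theorem IsEtThOrigin.exists_hom_commutatorClosure_zHat (hO : D.IsEtThOrigin) :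
    ∃ (a b : D.DeltaHat) (φ : ↥((⁅D.DeltaHat, D.DeltaHat⁆).topologicalClosure) →* ZHat),
      (Subgroup.closure ({a, b} : Set D.DeltaHat)).topologicalClosure = ⊤ ∧
      Function.Surjective φ ∧
      (∀ k, φ k = 1 ↔ (k : D.PiHat) ∈ (⁅⁅D.DeltaHat, D.DeltaHat⁆, D.DeltaHat⁆).topologicalClosure) ∧
      φ ⟨⁅(a : D.PiHat), (b : D.PiHat)⁆, Subgroup.le_topologicalClosure _
          (Subgroup.commutator_mem_commutator a.2 b.2)⟩ =
        etaFn (GrpCat.of (Multiplicative ℤ)) (Multiplicative.ofAdd (1 : ℤ)) := by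
  classical
  haveI : CompactSpace D.PiHat := D.isProfiniteCompletion_toHat.compactSpace
  haveI : T2Space D.PiHat := D.isProfiniteCompletion_toHat.t2Space
  haveI hΔn : D.DeltaHat.Normal := SettingCompletion.deltaHat_normal D.toTemperedCurve
  haveI hK₂n : (⁅D.DeltaHat, D.DeltaHat⁆).topologicalClosure.Normal :=
    Subgroup.is_normal_topologicalClosure _
  haveI hK₃n : (⁅⁅D.DeltaHat, D.DeltaHat⁆, D.DeltaHat⁆).topologicalClosure.Normal :=
    Subgroup.is_normal_topologicalClosure _
  set K₂ : Subgroup D.PiHat := (⁅D.DeltaHat, D.DeltaHat⁆).topologicalClosure with hK₂def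
  set K₃ : Subgroup D.PiHat := (⁅⁅D.DeltaHat, D.DeltaHat⁆, D.DeltaHat⁆).topologicalClosure with hK₃def
  have hK₂closed : IsClosed (K₂ : Set D.PiHat) := Subgroup.isClosed_topologicalClosure _
  have hK₃closed : IsClosed (K₃ : Set D.PiHat) := Subgroup.isClosed_topologicalClosure _
  have hΔclosed : IsClosed (D.DeltaHat : Set D.PiHat) := Subgroup.isClosed_topologicalClosure _
  have hK₃K₂ : K₃ ≤ K₂ :=
    Subgroup.topologicalClosure_mono (Subgroup.commutator_le_left _ _)
  have hK₂Δ : K₂ ≤ D.DeltaHat := fun x hx => D.commutatorClosure_le_deltaHat hx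
  -- the free pair, topologically generating `Δ_X`
  obtain ⟨hcpt, ht2, htd, -⟩ := hO.deltaHat_free
  haveI : CompactSpace D.DeltaHat := hcpt
  haveI : T2Space D.DeltaHat := ht2
  haveI : TotallyDisconnectedSpace D.DeltaHat := htd
  obtain ⟨a, b, huniv, hdense⟩ := hO.exists_topologicalGenerators
  set c : D.PiHat := ⁅(a : D.PiHat), (b : D.PiHat)⁆ with hcdef
  have hcK : c ∈ ⁅D.DeltaHat, D.DeltaHat⁆ := Subgroup.commutator_mem_commutator a.2 b.2
  have hcK₂ : c ∈ K₂ := Subgroup.le_topologicalClosure _ hcK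
  have hcΔ : c ∈ D.DeltaHat := hK₂Δ hcK₂
  have hc' : (⁅a, b⁆ : D.DeltaHat) = ⟨c, hcΔ⟩ := Subtype.ext (by
    simp only [commutatorElement_def, Subgroup.coe_mul, Subgroup.coe_inv, hcdef])
  -- `Ẑ`-powers of `c = [a, b]`: the continuous homomorphism `pw : Ẑ → Δ_X` with `pw (η m) = [a,b]^m`
  let G : GrpCat.{0} := GrpCat.of (Multiplicative ℤ)
  let P : ProfiniteGrp.{0} := ProfiniteGrp.of D.DeltaHat
  let f₀ : G ⟶ GrpCat.of P := GrpCat.ofHom (zpowersHom D.DeltaHat ⁅a, b⁆)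
  let pw := ProfiniteGrp.ProfiniteCompletion.lift f₀
  have hpw_eta : ∀ m : ℤ, pw.hom (etaFn G (Multiplicative.ofAdd m)) = (⁅a, b⁆ : D.DeltaHat) ^ m := by
    intro m
    have h := ConcreteCategory.congr_hom (ProfiniteGrp.ProfiniteCompletion.lift_eta f₀)
      (Multiplicative.ofAdd m)
    simp only [GrpCat.comp_apply] at h
    exact h
  have hpwc : Continuous pw.hom := pw.hom.continuous_toFun
  have hpw_coe : ∀ m : ℤ, ((pw.hom (etaFn G (Multiplicative.ofAdd m)) : D.DeltaHat) : D.PiHat) = c ^ m := by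
    intro m
    rw [hpw_eta, hc', Subgroup.coe_zpow]
  -- every `Ẑ`-power of `c` lies in `K₂` (closed, contains the dense set of integer powers)
  have hpwK₂ : ∀ t, ((pw.hom t : D.DeltaHat) : D.PiHat) ∈ K₂ := by
    have hcl : IsClosed {t : completion G | ((pw.hom t : D.DeltaHat) : D.PiHat) ∈ K₂} :=
      hK₂closed.preimage (continuous_subtype_val.comp hpwc)
    have hsub : Set.range (etaFn G) ⊆ {t : completion G | ((pw.hom t : D.DeltaHat) : D.PiHat) ∈ K₂} := by
      rintro _ ⟨m, rfl⟩
      change ((pw.hom (etaFn G (Multiplicative.ofAdd (Multiplicative.toAdd m))) : D.DeltaHat) : D.PiHat) ∈ K₂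
      rw [hpw_coe]
      exact K₂.zpow_mem hcK₂ _
    have huniv' : {t : completion G | ((pw.hom t : D.DeltaHat) : D.PiHat) ∈ K₂} = Set.univ := by
      refine Set.eq_univ_of_univ_subset ?_
      rw [← (ProfiniteGrp.ProfiniteCompletion.denseRange (G := G)).closure_range]
      exact hcl.closure_subset_iff.mpr hsub
    intro t
    have : t ∈ {t : completion G | ((pw.hom t : D.DeltaHat) : D.PiHat) ∈ K₂} := by
      rw [huniv']; trivial
    exact this
  -- ### (1) DECOMPOSITION `K₂ = [a,b]^Ẑ · K₃`: the set `S = pw(Ẑ) · K₃` is a closed subgroup of `Π_X`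
  let S : Subgroup D.PiHat :=
    { carrier := {x | ∃ t : completion G, ∃ k ∈ K₃, x = ((pw.hom t : D.DeltaHat) : D.PiHat) * k}
      one_mem' := ⟨1, 1, one_mem _, by rw [map_one, Subgroup.coe_one, one_mul]⟩
      mul_mem' := by
        rintro _ _ ⟨t, k, hk, rfl⟩ ⟨t', k', hk', rfl⟩
        refine ⟨t * t', (((pw.hom t' : D.DeltaHat) : D.PiHat))⁻¹ * k * ((pw.hom t' : D.DeltaHat) : D.PiHat) * k',
          K₃.mul_mem ?_ hk', ?_⟩
        · have := hK₃n.conj_mem k hk (((pw.hom t' : D.DeltaHat) : D.PiHat))⁻¹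
          rwa [inv_inv] at this
        · rw [map_mul, Subgroup.coe_mul]; group
      inv_mem' := by
        rintro _ ⟨t, k, hk, rfl⟩
        refine ⟨t⁻¹, ((pw.hom t : D.DeltaHat) : D.PiHat) * k⁻¹ * (((pw.hom t : D.DeltaHat) : D.PiHat))⁻¹,
          hK₃n.conj_mem _ (K₃.inv_mem hk) _, ?_⟩
        rw [map_inv, Subgroup.coe_inv]; group }
  have hS_mem : ∀ x, x ∈ S ↔ ∃ t : completion G, ∃ k ∈ K₃, x = ((pw.hom t : D.DeltaHat) : D.PiHat) * k :=
    fun x => Iff.rfl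
  have hSclosed : IsClosed (S : Set D.PiHat) := by
    have hK₃cpt : IsCompact (K₃ : Set D.PiHat) := hK₃closed.isCompact
    have himage : (S : Set D.PiHat) =
        (fun q : completion G × D.PiHat => ((pw.hom q.1 : D.DeltaHat) : D.PiHat) * q.2) ''
          ((Set.univ : Set (completion G)) ×ˢ (K₃ : Set D.PiHat)) := by
      ext x
      simp only [SetLike.mem_coe, hS_mem, Set.mem_image, Set.mem_prod, Set.mem_univ, true_and,
        Prod.exists]
      constructor
      · rintro ⟨t, k, hk, rfl⟩; exact ⟨t, k, hk, rfl⟩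
      · rintro ⟨t, k, hk, rfl⟩; exact ⟨t, k, hk, rfl⟩
    rw [himage]
    refine (IsCompact.image (isCompact_univ.prod hK₃cpt) ?_).isClosed
    exact ((continuous_subtype_val.comp hpwc).comp continuous_fst).mul continuous_snd
  have hS_zpow : ∀ (m : ℤ) (k : D.PiHat), k ∈ K₃ → c ^ m * k ∈ S := fun m k hk =>
    ⟨etaFn G (Multiplicative.ofAdd m), k, hk, by rw [hpw_coe]⟩
  -- commutators of elements of `⟨a, b⟩` lie in `S` (class-two normal forms modulo `K₃`)
  have hS_comm_gen : ∀ u ∈ Subgroup.closure ({a, b} : Set D.DeltaHat),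
      ∀ v ∈ Subgroup.closure ({a, b} : Set D.DeltaHat), ⁅(u : D.PiHat), (v : D.PiHat)⁆ ∈ S := by
    intro u hu v hv
    let π : D.PiHat →* D.PiHat ⧸ K₃ := QuotientGroup.mk' K₃
    let A : Subgroup (D.PiHat ⧸ K₃) :=
      ((Subgroup.closure ({a, b} : Set D.DeltaHat)).map D.DeltaHat.subtype).map π
    have hAgen : A = Subgroup.closure ({π a, π b} : Set (D.PiHat ⧸ K₃)) := by
      simp only [A, MonoidHom.map_closure, Set.image_pair, Subgroup.coe_subtype]
    have hAle : A ≤ (D.DeltaHat.map π) := Subgroup.map_mono (Subgroup.map_subtype_le _)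
    have h3 : ⁅⁅A, A⁆, A⁆ = ⊥ := by
      rw [eq_bot_iff]
      calc ⁅⁅A, A⁆, A⁆ ≤ ⁅⁅D.DeltaHat.map π, D.DeltaHat.map π⁆, D.DeltaHat.map π⁆ :=
            Subgroup.commutator_mono (Subgroup.commutator_mono hAle hAle) hAle
        _ = (⁅⁅D.DeltaHat, D.DeltaHat⁆, D.DeltaHat⁆).map π := by
            rw [Subgroup.map_commutator, Subgroup.map_commutator]
        _ ≤ K₃.map π := Subgroup.map_mono (Subgroup.le_topologicalClosure _)
        _ = ⊥ := by
            rw [eq_bot_iff]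
            rintro _ ⟨k, hk, rfl⟩
            exact (QuotientGroup.eq_one_iff k).mpr hk
    have hαA : π a ∈ A := by rw [hAgen]; exact Subgroup.subset_closure (Set.mem_insert _ _)
    have hβA : π b ∈ A := by
      rw [hAgen]; exact Subgroup.subset_closure (Set.mem_insert_of_mem _ (Set.mem_singleton _))
    have hcyc := commutator_le_zpowers_of_classTwo A hαA hβA hAgen.le h3
    have huA : π u ∈ A := ⟨u, ⟨u, hu, rfl⟩, rfl⟩
    have hvA : π v ∈ A := ⟨v, ⟨v, hv, rfl⟩, rfl⟩
    have hmem : ⁅π u, π v⁆ ∈ Subgroup.zpowers ⁅π a, π b⁆ :=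
      hcyc (Subgroup.commutator_mem_commutator huA hvA)
    obtain ⟨m, hm⟩ := Subgroup.mem_zpowers_iff.mp hmem
    rw [← map_commutatorElement, ← map_commutatorElement, ← hcdef, ← map_zpow] at hm
    -- `π (c ^ m) = π [u, v]`, so `[u, v] = c ^ m · k` with `k ∈ K₃`
    have hk : (c ^ m)⁻¹ * ⁅(u : D.PiHat), (v : D.PiHat)⁆ ∈ K₃ := by
      rw [← QuotientGroup.eq]; exact hm
    have := hS_zpow m _ hk
    rwa [mul_inv_cancel_left] at this
  -- all commutators of `Δ_X` lie in `S` (density of `⟨a, b⟩`, closedness of `S`)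
  have hS_comm : ⁅D.DeltaHat, D.DeltaHat⁆ ≤ S := by
    refine Subgroup.commutator_le.mpr fun u hu v hv => ?_
    let T : Set (D.DeltaHat × D.DeltaHat) := {q | ⁅((q.1 : D.DeltaHat) : D.PiHat), ((q.2 : D.DeltaHat) : D.PiHat)⁆ ∈ S}
    have hTclosed : IsClosed T := by
      refine hSclosed.preimage ?_
      have h1 : Continuous fun q : D.DeltaHat × D.DeltaHat => ((q.1 : D.DeltaHat) : D.PiHat) :=
        continuous_subtype_val.comp continuous_fst
      have h2 : Continuous fun q : D.DeltaHat × D.DeltaHat => ((q.2 : D.DeltaHat) : D.PiHat) :=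
        continuous_subtype_val.comp continuous_snd
      simp only [commutatorElement_def]
      exact ((h1.mul h2).mul h1.inv).mul h2.inv
    have hAdense : Dense ((Subgroup.closure ({a, b} : Set D.DeltaHat) : Subgroup D.DeltaHat) :
        Set D.DeltaHat) := by
      rw [dense_iff_closure_eq, ← Subgroup.topologicalClosure_coe, hdense, Subgroup.coe_top]
    have hsub : ((Subgroup.closure ({a, b} : Set D.DeltaHat) : Set D.DeltaHat) ×ˢ
        (Subgroup.closure ({a, b} : Set D.DeltaHat) : Set D.DeltaHat)) ⊆ T := by
      rintro ⟨u', v'⟩ ⟨hu', hv'⟩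
      exact hS_comm_gen u' hu' v' hv'
    have hT : T = Set.univ := by
      refine Set.eq_univ_of_univ_subset ?_
      rw [← (hAdense.prod hAdense).closure_eq]
      exact hTclosed.closure_subset_iff.mpr hsub
    have : ((⟨u, hu⟩ : D.DeltaHat), (⟨v, hv⟩ : D.DeltaHat)) ∈ T := by rw [hT]; trivial
    exact this
  have hK₂S : K₂ ≤ S := Subgroup.topologicalClosure_minimal _ hS_comm hSclosed
  -- ### (2) HEISENBERG INJECTIVITY: a `Ẑ`-power of `c` lying in `K₃` is trivial
  have hinj_core : ∀ t : completion G, ((pw.hom t : D.DeltaHat) : D.PiHat) ∈ K₃ → t = 1 := by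
    intro t ht
    apply Subtype.ext
    funext N
    obtain ⟨n, hn, hN⟩ := exists_eq_zpowers N.toSubgroup
    haveI : NeZero n := ⟨hn.ne'⟩
    -- the finite Heisenberg test group `H(ℤ/n)`: class two, `[x, y]` of order exactly `n`
    obtain ⟨H, hHgrp, hHfin, x, y, horder, hQ3⟩ := exists_classTwo_commutator_orderOf n
    letI : Group H := hHgrp
    haveI : Finite H := hHfin
    letI : TopologicalSpace H := ⊥
    haveI : DiscreteTopology H := ⟨rfl⟩
    -- the continuous homomorphism `F : Δ_X → H` with `F a = x`, `F b = y`; it kills `K₃`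
    obtain ⟨F, ⟨hFa, hFb⟩, -⟩ := huniv (H) x y
    have hFc : Continuous F.toMonoidHom := F.continuous_toFun
    have hF2 : ∀ g : D.DeltaHat, (g : D.PiHat) ∈ ⁅D.DeltaHat, D.DeltaHat⁆.topologicalClosure →
        F.toMonoidHom g ∈ (⁅(⊤ : Subgroup (H)), (⊤ : Subgroup (H))⁆ :
          Subgroup (H)) := by
      have h2 : (⁅D.DeltaHat, D.DeltaHat⁆).topologicalClosure ≤
          ((⁅(⊤ : Subgroup (H)), (⊤ : Subgroup (H))⁆ :
            Subgroup (H)).comap F.toMonoidHom).map D.DeltaHat.subtype := by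
        refine Subgroup.topologicalClosure_minimal _ (Subgroup.commutator_le.mpr ?_)
          (isClosed_map_subtype_comap hΔclosed F.toMonoidHom hFc _)
        intro g₁ hg₁ g₂ hg₂
        refine ⟨⁅(⟨g₁, hg₁⟩ : D.DeltaHat), ⟨g₂, hg₂⟩⁆, ?_, rfl⟩
        rw [SetLike.mem_coe, Subgroup.mem_comap, map_commutatorElement]
        exact Subgroup.commutator_mem_commutator (Subgroup.mem_top (F.toMonoidHom ⟨g₁, hg₁⟩))
          (Subgroup.mem_top (F.toMonoidHom ⟨g₂, hg₂⟩))
      exact fun g hg => mem_of_coe_mem_map_subtype_comap F.toMonoidHom _ (h2 hg)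
    have hF3 : ∀ g : D.DeltaHat,
        (g : D.PiHat) ∈ (⁅⁅D.DeltaHat, D.DeltaHat⁆, D.DeltaHat⁆).topologicalClosure → F.toMonoidHom g = 1 := by
      have h3 : (⁅⁅D.DeltaHat, D.DeltaHat⁆, D.DeltaHat⁆).topologicalClosure ≤
          ((⁅⁅(⊤ : Subgroup (H)), (⊤ : Subgroup (H))⁆,
            (⊤ : Subgroup (H))⁆ : Subgroup (H)).comap
            F.toMonoidHom).map D.DeltaHat.subtype := by
        refine Subgroup.topologicalClosure_minimal _ (Subgroup.commutator_le.mpr ?_)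
          (isClosed_map_subtype_comap hΔclosed F.toMonoidHom hFc _)
        intro c₀ hc₀ g hg
        have hc₀' : c₀ ∈ D.DeltaHat := D.commutatorClosure_le_deltaHat (Subgroup.le_topologicalClosure _ hc₀)
        refine ⟨⁅(⟨c₀, hc₀'⟩ : D.DeltaHat), ⟨g, hg⟩⁆, ?_, rfl⟩
        rw [SetLike.mem_coe, Subgroup.mem_comap, map_commutatorElement]
        exact Subgroup.commutator_mem_commutator
          (hF2 ⟨c₀, hc₀'⟩ (Subgroup.le_topologicalClosure _ hc₀)) (Subgroup.mem_top (F.toMonoidHom ⟨g, hg⟩))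
      intro g hg
      exact hQ3 _ (mem_of_coe_mem_map_subtype_comap F.toMonoidHom _ (h3 hg))
    have hFpow : ∀ m : ℤ, F (pw.hom (etaFn G (Multiplicative.ofAdd m))) = (⁅x, y⁆ : H) ^ m := by
      intro m
      rw [hpw_eta, map_zpow, map_commutatorElement, hFa, hFb]
    obtain ⟨g, hg'⟩ : ∃ g : Multiplicative ℤ,
        t.val N = (QuotientGroup.mk (Multiplicative.ofAdd (Multiplicative.toAdd g)) : _ ⧸ N.toSubgroup) := by
      obtain ⟨g, hg⟩ := QuotientGroup.mk_surjective (t.val N : Multiplicative ℤ ⧸ N.toSubgroup)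
      exact ⟨g, hg.symm⟩
    have hzn : (⁅x, y⁆ : H) ^ n = 1 := by
      have h := pow_orderOf_eq_one (⁅x, y⁆ : H)
      rwa [horder] at h
    have hFt : F (pw.hom t) = (⁅x, y⁆ : H) ^ (Multiplicative.toAdd g) :=
      apply_pow_eq_zpow pw.hom F (⁅x, y⁆ : H) hzn N hN hFpow t hg'
    have hFt1 : F (pw.hom t) = 1 := hF3 _ ht
    have hval : t.val N = 1 :=
      val_eq_one_of_zpow_eq_one (⁅x, y⁆ : H) horder N hN t hg' (hFt.symm.trans hFt1)
    exact hval
  -- ### (3) ASSEMBLY: `ψ : Ẑ → K₂/K₃`, `t ↦ [c^t]`, is a bijective homomorphism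
  haveI hK₃n' : (K₃.subgroupOf K₂).Normal := inferInstance
  let pwK₂ : completion G →* K₂ :=
    { toFun := fun t => ⟨((pw.hom t : D.DeltaHat) : D.PiHat), hpwK₂ t⟩
      map_one' := Subtype.ext (by
        change ((pw.hom 1 : D.DeltaHat) : D.PiHat) = 1
        rw [map_one, Subgroup.coe_one])
      map_mul' := fun t t' => Subtype.ext (by
        change ((pw.hom (t * t') : D.DeltaHat) : D.PiHat) =
          ((pw.hom t : D.DeltaHat) : D.PiHat) * ((pw.hom t' : D.DeltaHat) : D.PiHat)
        rw [map_mul, Subgroup.coe_mul]) }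
  have hpwK₂_coe : ∀ t, ((pwK₂ t : K₂) : D.PiHat) = ((pw.hom t : D.DeltaHat) : D.PiHat) := fun t => rfl
  let ψ : completion G →* (K₂ ⧸ K₃.subgroupOf K₂) := (QuotientGroup.mk' (K₃.subgroupOf K₂)).comp pwK₂
  have hψ_apply : ∀ t, ψ t = QuotientGroup.mk (pwK₂ t) := fun t => rfl
  have hψ_inj : Function.Injective ψ := by
    rw [injective_iff_map_eq_one]
    intro t ht
    rw [hψ_apply, QuotientGroup.eq_one_iff, Subgroup.mem_subgroupOf, hpwK₂_coe] at ht
    exact hinj_core t ht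
  have hψ_surj : Function.Surjective ψ := by
    intro q
    obtain ⟨k, rfl⟩ := QuotientGroup.mk_surjective q
    obtain ⟨t, k₃, hk₃, hk⟩ := (hS_mem _).mp (hK₂S k.2)
    refine ⟨t, ?_⟩
    rw [hψ_apply, QuotientGroup.eq, Subgroup.mem_subgroupOf, Subgroup.coe_mul, Subgroup.coe_inv,
      hpwK₂_coe, hk, inv_mul_cancel_left]
    exact hk₃
  let e : (K₂ ⧸ K₃.subgroupOf K₂) ≃* completion G := (MulEquiv.ofBijective ψ ⟨hψ_inj, hψ_surj⟩).symm
  have he_ψ : ∀ t, e (ψ t) = t := fun t =>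
    (MulEquiv.ofBijective ψ ⟨hψ_inj, hψ_surj⟩).symm_apply_apply t
  let φ : K₂ →* completion G := e.toMonoidHom.comp (QuotientGroup.mk' (K₃.subgroupOf K₂))
  have hφ_apply : ∀ k, φ k = e (QuotientGroup.mk k) := fun k => rfl
  refine ⟨a, b, φ, hdense, ?_, ?_, ?_⟩
  · -- surjective
    exact e.surjective.comp (QuotientGroup.mk'_surjective _)
  · -- kernel = `K₃`
    intro k
    rw [hφ_apply, e.map_eq_one_iff, QuotientGroup.eq_one_iff, Subgroup.mem_subgroupOf]
  · -- normalisation `[a, b] ↦ η 1`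
    have h1 : ψ (etaFn G (Multiplicative.ofAdd (1 : ℤ))) =
        QuotientGroup.mk ⟨c, hcK₂⟩ := by
      rw [hψ_apply]
      congr 1
      apply Subtype.ext
      rw [hpwK₂_coe]
      exact (hpw_coe 1).trans (zpow_one c)
    have h2 : (⟨⁅(a : D.PiHat), (b : D.PiHat)⁆, Subgroup.le_topologicalClosure _
        (Subgroup.commutator_mem_commutator a.2 b.2)⟩ : K₂) = ⟨c, hcK₂⟩ := Subtype.ext rfl
    rw [hφ_apply, h2, ← h1, he_ψ]

/-- **`[Δ_X,Δ_X]⁻/[[Δ_X,Δ_X],Δ_X]⁻ ≅ Ẑ`, quotient form** ("`∧² Δ^ell_X (≅ Ẑ(1))`", p. 12): under the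
freeness guard there are topological generators `a, b` of `Δ_X` and a group isomorphism of the
commutator quotient with `Ẑ` sending the class of `[a, b]` to `1 ∈ ℤ ⊆ Ẑ`.  The quotient GROUP
structure needs the normality of `[[Δ_X,Δ_X],Δ_X]⁻` as an INSTANCE, taken as an instance-implicit
binder (discharge it with `Subgroup.is_normal_topologicalClosure` after `SettingCompletion.deltaHat_normal`).
This is the signature consumed by the tempered transport `Δ_Θ ≅ Ẑ` (GAP-LEDGER G-w4d021-1, part (A′),
seat abc-iut-L2-d1). [cite: MochizukiEtTh2009, §1 p.12] -/
theorem IsEtThOrigin.exists_zHat_param_commutatorClosure (hO : D.IsEtThOrigin)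
    [((⁅⁅D.DeltaHat, D.DeltaHat⁆, D.DeltaHat⁆).topologicalClosure).Normal] :
    ∃ (a b : D.DeltaHat) (_ : (Subgroup.closure ({a, b} : Set D.DeltaHat)).topologicalClosure = ⊤)
      (e : ↥((⁅D.DeltaHat, D.DeltaHat⁆).topologicalClosure) ⧸
            ((⁅⁅D.DeltaHat, D.DeltaHat⁆, D.DeltaHat⁆).topologicalClosure).subgroupOf
              (⁅D.DeltaHat, D.DeltaHat⁆).topologicalClosure ≃* ZHat),
      e (QuotientGroup.mk ⟨⁅(a : D.PiHat), (b : D.PiHat)⁆, Subgroup.le_topologicalClosure _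
          (Subgroup.commutator_mem_commutator a.2 b.2)⟩) =
        etaFn (GrpCat.of (Multiplicative ℤ)) (Multiplicative.ofAdd (1 : ℤ)) := by
  obtain ⟨a, b, φ, hdense, hsurj, hker, hab⟩ := hO.exists_hom_commutatorClosure_zHat
  have hkerEq : φ.ker = ((⁅⁅D.DeltaHat, D.DeltaHat⁆, D.DeltaHat⁆).topologicalClosure).subgroupOf
      (⁅D.DeltaHat, D.DeltaHat⁆).topologicalClosure := by
    ext k
    rw [MonoidHom.mem_ker, hker k, Subgroup.mem_subgroupOf]
  refine ⟨a, b, hdense, (QuotientGroup.quotientMulEquivOfEq hkerEq).symm.trans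
    (QuotientGroup.quotientKerEquivOfSurjective φ hsurj), ?_⟩
  rw [← hab]
  rfl

/-- **`[Δ_X,Δ_X]⁻/[[Δ_X,Δ_X],Δ_X]⁻ ≅ Ẑ`** as a bare `Nonempty` ("`∧² Δ^ell_X (≅ Ẑ(1))`", p. 12; same
instance-implicit normality binder as `exists_zHat_param_commutatorClosure`).
[cite: MochizukiEtTh2009, §1 p.12] -/
theorem IsEtThOrigin.nonempty_commutatorQuotient_mulEquiv_zHat (hO : D.IsEtThOrigin)
    [((⁅⁅D.DeltaHat, D.DeltaHat⁆, D.DeltaHat⁆).topologicalClosure).Normal] :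
    Nonempty (↥((⁅D.DeltaHat, D.DeltaHat⁆).topologicalClosure) ⧸
      ((⁅⁅D.DeltaHat, D.DeltaHat⁆, D.DeltaHat⁆).topologicalClosure).subgroupOf
        (⁅D.DeltaHat, D.DeltaHat⁆).topologicalClosure ≃* ZHat) := by
  obtain ⟨_, _, _, e, -⟩ := hO.exists_zHat_param_commutatorClosure
  exact ⟨e⟩

end ThetaSetting

end Literature.AnabelianGeometry.EtaleTheta

end
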